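import Literature.Probability.LatticeModels.TorusFourierDecayProduct
import HarnessLib

/-!
# Anisotropic decay of character sums on a product torus from several directional difference bounds

Topic `Literature/Probability/LatticeModels`; continues `TorusFourierDecayProduct.lean`.  The single-scale sector
propagator of a two-dimensional lattice fermion model at positive temperature and finite volume is a character sum
`g(z₁,z₂) = Σ_{p} χ_{p₁}(z₁)χ_{p₂}(z₂) • G(p)` over the product of the time dual torus `(ℤ/L₁ℤ)^{d₁}` (Matsubara
indices) and the spatial dual torus `(ℤ/L₂ℤ)^{d₂}`, and the bound of Benfatto–Giuliani–Mastropietro 2006, Lemma 2.2,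
`|g(x)| ≤ C_N γ^{3h/2} (1 + γ^h|x₀| + γ^h|x'₁| + γ^{h/2}|x'₂|)^{-N}` (at finite `L`, footnote ¹), is the COMBINATION of
one-directional decay bounds: differences of the symbol in the time index, along the lattice axes, and along integer
approximants of the normal / tangent directions of the sector.  This file assembles them:

* **`valMinAbs_sum_intCast_mul_eq`** — the NEAR REGION: for an integer step
  `v` and a point `z` with `2|Σⱼ vⱼ z̃ⱼ| < L` (`z̃ⱼ = valMinAbs zⱼ` the centred coordinates), the decay variable of
  `TorusFourierDecayFromDifferences` is LINEAR, `valMinAbs (Σⱼ vⱼ zⱼ) = Σⱼ vⱼ z̃ⱼ` — the coordinate of `z̃` along `v`;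
  `two_mul_abs_sum_mul_valMinAbs_lt_of_norm` — a sufficient condition `2 (Σⱼ|vⱼ|) max|z̃ⱼ| < L`;
* **`norm_sum_prodChar_smul_mul_one_add_pow_le`** — for finite families of first-factor steps `vᵢ` with rates
  `cᵢ ≥ 0` (`i ∈ I₁`) and second-factor steps `wᵢ` with rates `cᵢ ≥ 0` (`i ∈ I₂`),
  `‖g(z)‖ · (1 + Σ_{I₁} cᵢ · 4|ã_{vᵢ}(z₁)|/L₁ + Σ_{I₂} cᵢ · 4|ã_{wᵢ}(z₂)|/L₂)^N
     ≤ (|I₁| + |I₂| + 1)^N · (Σ_p ‖G p‖ + Σ_{I₁} cᵢ^N Σ_p ‖Δ_{(vᵢ,0)}^N G‖ + Σ_{I₂} cᵢ^N Σ_p ‖Δ_{(0,wᵢ)}^N G‖)`,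
  `ã_v(z) = valMinAbs (Σⱼ vⱼ zⱼ)`: a symbol of size `A` on `n` momenta whose `N`-th differences along `vᵢ` are of size
  `A (cᵢ Lᵢ/4)^{-N}` gives a sum decaying at rate `cᵢ` in the coordinate dual to `vᵢ`, all directions at once.

Everything is proved; no definitions, no named facts. [folklore]

## Sources

G. Benfatto, A. Giuliani, V. Mastropietro, Ann. Henri Poincaré 7 (2006) 809–898, Lemma 2.2, (2.36aa) and footnote ¹
(`BenfattoGiulianiMastropietro2006`); G. Benfatto, V. Mastropietro, Rev. Math. Phys. 13 (2001) 1323–1435, §2.3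
(`BenfattoMastropietro2001`).
-/

noncomputable section

open Finset Complex
open scoped Real ComplexConjugate

namespace Literature.Probability.LatticeModels

/-! ### The near region: linearity of the centred representative -/

/-- **Near-region linearity**: for an integer step `v` and a point `z` of the torus with `2|Σⱼ vⱼ z̃ⱼ| < L`
(`z̃ⱼ = valMinAbs zⱼ`), `valMinAbs (Σⱼ vⱼ zⱼ) = Σⱼ vⱼ z̃ⱼ`. [folklore] -/
theorem valMinAbs_sum_intCast_mul_eq {d L : ℕ} [NeZero L] (v : Fin d → ℤ) (z : TorusSite d L)
    (h : 2 * |∑ j, v j * (z j).valMinAbs| < L) :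
    (∑ j, (v j : ZMod L) * z j).valMinAbs = ∑ j, v j * (z j).valMinAbs := by
  have hz : (∑ j, (v j : ZMod L) * z j) = ((∑ j, v j * (z j).valMinAbs : ℤ) : ZMod L) := by
    simp only [Int.cast_sum, Int.cast_mul, ZMod.coe_valMinAbs]
  -- the centred representative of a small integer is itself (`ZMod.valMinAbs_spec`)
  rw [hz, ZMod.valMinAbs_spec]
  exact ⟨rfl, by linarith [neg_abs_le (∑ j, v j * (z j).valMinAbs)], by linarith [le_abs_self (∑ j, v j * (z j).valMinAbs)]⟩

/-- A sufficient condition for the near region: `2 (Σⱼ |vⱼ| |z̃ⱼ|) < L`. [folklore] -/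
theorem two_mul_abs_sum_mul_valMinAbs_lt {d L : ℕ} (v : Fin d → ℤ) (z : TorusSite d L)
    (h : 2 * ∑ j, |v j| * |(z j).valMinAbs| < L) : 2 * |∑ j, v j * (z j).valMinAbs| < L :=
  lt_of_le_of_lt (mul_le_mul_of_nonneg_left ((abs_sum_le_sum_abs _ _).trans (le_of_eq
    (sum_congr rfl fun _ _ => abs_mul _ _))) zero_le_two) h

/-- The near region in `ℓ^∞` form: if every centred coordinate satisfies `|z̃ⱼ| ≤ R` and `2 (Σⱼ|vⱼ|) R < L` then
`2|Σⱼ vⱼ z̃ⱼ| < L`. [folklore] -/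
theorem two_mul_abs_sum_mul_valMinAbs_lt_of_norm {d L : ℕ} (v : Fin d → ℤ) (z : TorusSite d L) {R : ℤ}
    (hz : ∀ j, |(z j).valMinAbs| ≤ R) (h : 2 * (∑ j, |v j|) * R < L) : 2 * |∑ j, v j * (z j).valMinAbs| < L := by
  refine two_mul_abs_sum_mul_valMinAbs_lt v z (lt_of_le_of_lt ?_ h)
  rw [mul_assoc, sum_mul]
  exact mul_le_mul_of_nonneg_left (sum_le_sum fun j _ => mul_le_mul_of_nonneg_left (hz j) (abs_nonneg _)) zero_le_two

/-! ### Combination of directional difference bounds -/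

section Product

variable {d₁ d₂ L₁ L₂ : ℕ} [NeZero L₁] [NeZero L₂] {E : Type*} [NormedAddCommGroup E] [NormedSpace ℂ E]

/-- The trivial bound: `‖Σ_p χχ • G p‖ ≤ Σ_p ‖G p‖`. [folklore] -/
theorem norm_sum_prodChar_smul_le (G : TorusSite d₁ L₁ × TorusSite d₂ L₂ → E) (z₁ : TorusSite d₁ L₁) (z₂ : TorusSite d₂ L₂) :
    ‖∑ p, (torusChar p.1 z₁ * torusChar p.2 z₂) • G p‖ ≤ ∑ p, ‖G p‖ :=
  (norm_sum_le _ _).trans (le_of_eq (sum_congr rfl fun p _ => by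
    rw [norm_smul, norm_mul, norm_torusChar, norm_torusChar, one_mul, one_mul]))

/-- **Anisotropic decay from several directional difference bounds** (Benfatto–Giuliani–Mastropietro 2006, Lemma 2.2
at finite volume): for first-factor steps `vᵢ`, `i ∈ I₁`, and second-factor steps `wᵢ`, `i ∈ I₂`, with rates `cᵢ ≥ 0`,
`‖g(z)‖ (1 + Σ_{I₁} cᵢ 4|ã_{vᵢ}(z₁)|/L₁ + Σ_{I₂} cᵢ 4|ã_{wᵢ}(z₂)|/L₂)^N ≤ (|I₁|+|I₂|+1)^N (Σ‖G‖ + Σ_{I₁} cᵢ^N Σ‖Δ_{(vᵢ,0)}^N G‖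
+ Σ_{I₂} cᵢ^N Σ‖Δ_{(0,wᵢ)}^N G‖)`. [cite: BenfattoGiulianiMastropietro2006, Lemma 2.2 and footnote 1] -/
theorem norm_sum_prodChar_smul_mul_one_add_pow_le {ι₁ ι₂ : Type*} (I₁ : Finset ι₁) (I₂ : Finset ι₂)
    (G : TorusSite d₁ L₁ × TorusSite d₂ L₂ → E) (z₁ : TorusSite d₁ L₁) (z₂ : TorusSite d₂ L₂) (N : ℕ)
    (v : ι₁ → TorusSite d₁ L₁) (w : ι₂ → TorusSite d₂ L₂) (c₁ : ι₁ → ℝ) (c₂ : ι₂ → ℝ)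
    (hc₁ : ∀ i ∈ I₁, 0 ≤ c₁ i) (hc₂ : ∀ i ∈ I₂, 0 ≤ c₂ i) :
    ‖∑ p, (torusChar p.1 z₁ * torusChar p.2 z₂) • G p‖ *
        (1 + ∑ i ∈ I₁, c₁ i * (4 * |((∑ j, v i j * z₁ j).valMinAbs : ℝ)| / L₁)
           + ∑ i ∈ I₂, c₂ i * (4 * |((∑ j, w i j * z₂ j).valMinAbs : ℝ)| / L₂)) ^ N ≤
      ((I₁.card : ℝ) + I₂.card + 1) ^ N *
        (∑ p, ‖G p‖ + ∑ i ∈ I₁, c₁ i ^ N * ∑ p, ‖((fwdDiff (v i, (0 : TorusSite d₂ L₂)))^[N] G) p‖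
          + ∑ i ∈ I₂, c₂ i ^ N * ∑ p, ‖((fwdDiff ((0 : TorusSite d₁ L₁), w i))^[N] G) p‖) := by
  set a : ℝ := ‖∑ p, (torusChar p.1 z₁ * torusChar p.2 z₂) • G p‖ with ha
  -- the decay variables and the bounds, indexed by the disjoint union of the two families
  set b : ι₁ ⊕ ι₂ → ℝ := Sum.elim (fun i => c₁ i * (4 * |((∑ j, v i j * z₁ j).valMinAbs : ℝ)| / L₁))
    (fun i => c₂ i * (4 * |((∑ j, w i j * z₂ j).valMinAbs : ℝ)| / L₂)) with hb
  set S : ι₁ ⊕ ι₂ → ℝ := Sum.elim (fun i => c₁ i ^ N * ∑ p, ‖((fwdDiff (v i, (0 : TorusSite d₂ L₂)))^[N] G) p‖)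
    (fun i => c₂ i ^ N * ∑ p, ‖((fwdDiff ((0 : TorusSite d₁ L₁), w i))^[N] G) p‖) with hS
  have hb0 : ∀ i ∈ I₁.disjSum I₂, 0 ≤ b i := by
    intro i hi
    rcases Finset.mem_disjSum.1 hi with ⟨i, hi', rfl⟩ | ⟨i, hi', rfl⟩
    · exact mul_nonneg (hc₁ i hi') (by positivity)
    · exact mul_nonneg (hc₂ i hi') (by positivity)
  have hbS : ∀ i ∈ I₁.disjSum I₂, a * b i ^ N ≤ S i := by
    intro i hi
    rcases Finset.mem_disjSum.1 hi with ⟨i, hi', rfl⟩ | ⟨i, hi', rfl⟩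
    · show a * (c₁ i * (4 * |((∑ j, v i j * z₁ j).valMinAbs : ℝ)| / L₁)) ^ N ≤
        c₁ i ^ N * ∑ p, ‖((fwdDiff (v i, (0 : TorusSite d₂ L₂)))^[N] G) p‖
      rw [mul_pow, mul_left_comm]
      exact mul_le_mul_of_nonneg_left (norm_sum_prodChar_smul_mul_pow_le_fst G (v i) z₁ z₂ N) (pow_nonneg (hc₁ i hi') N)
    · show a * (c₂ i * (4 * |((∑ j, w i j * z₂ j).valMinAbs : ℝ)| / L₂)) ^ N ≤
        c₂ i ^ N * ∑ p, ‖((fwdDiff ((0 : TorusSite d₁ L₁), w i))^[N] G) p‖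
      rw [mul_pow, mul_left_comm]
      exact mul_le_mul_of_nonneg_left (norm_sum_prodChar_smul_mul_pow_le_snd G z₁ (w i) z₂ N) (pow_nonneg (hc₂ i hi') N)
  have hmain := mul_one_add_sum_pow_le (I₁.disjSum I₂) N (norm_nonneg _) b S
    (norm_sum_prodChar_smul_le G z₁ z₂) hb0 hbS
  rw [Finset.sum_disjSum, Finset.sum_disjSum, Finset.card_disjSum, Nat.cast_add] at hmain
  simpa only [hb, hS, Sum.elim_inl, Sum.elim_inr, ← ha, add_assoc] using hmain

end Product

end Literature.Probability.LatticeModels
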